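import Literature.AnabelianGeometry.AbsoluteAnabelian.AbsTopII.BelyiCuspidalizationChainU

/-!
# [AbsTopII] Cor 3.7″ ⟹ Cor 3.7; v1 ⟺ v2 when `n = 0` (PROOF-ONLY companion of `BelyiCuspidalizationChainU.lean`)

S. Mochizuki, *Topics in Absolute Anabelian Geometry II* [AbsTopII] (bib `MochizukiAbsTopII2013`, kurims
manuscript `paper:url-585b8d0ad0d9`), §3 Cor 3.7 pp. 72–73, Ex 3.6 (i) p. 71.

No definition.  PROVED (abc-iut-L4-t6; finding F-f067g2-1, successor v2 `RealizesChain'` / `Cor_3_7″`):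
`RealizesChain'.hasTerminalChainOfType` (v2 refines the recorded chain clause),
`BelyiModel.cor_3_7_of_cor_3_7''` (`Cor_3_7″ → Cor_3_7`, p407799),
`RealizesChain'.projU_injective_of_m_eq_zero` (an EMPTY `U`-block, `m = 0`, forces `Π_U ↠ Π_V`
injective — the v2 certificate shape: outputs that actually remove points realize no such chain),
`RealizesChain'.realizesChain_of_n_eq_zero` / `RealizesChain.realizesChain'_of_n_eq_zero` (v1 and v2
AGREE when `n = 0`, i.e. `W = U`: the v1 predicate was the `W = U` reading).  Typed ≠ proved; nothing
here bears on [IUTchIII] Cor 3.12.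
-/

open CategoryTheory Topology

universe u

namespace Literature.AnabelianGeometry.AbsoluteAnabelian.AbsTopII

open Literature.AlgebraicGeometry.Frobenioids (IsSlimGroup)
open FundamentalExtension
open AbsTopI (ConstructionDataClass)

namespace BelyiCuspidalization

variable {E : FundamentalExtension.{u}} {B : BelyiCuspidalization E} {C : CuspidalData E}
  {hP : IsSlimGroup E.arith} {hΔ : IsSlimGroup E.geom} {hne : E.geom ≠ ⊥}

/-- v2 refines the recorded chain clause `HasTerminalChainOfType … B.typeChain B.PiV`.
[cite: MochizukiAbsTopII2013, Cor 3.7 (a) p.73] -/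
theorem RealizesChain'.hasTerminalChainOfType (h : B.RealizesChain' C hP hΔ hne) :
    HasTerminalChainOfType C hP hΔ hne B.typeChain B.PiV := by
  obtain ⟨c, htype, hiso, w, s, t, -, -, ht, -, eV, -, gV, -, -, heV, -⟩ := h
  exact ⟨c, htype, hiso, t, ht, eV, gV, heV⟩

/-- **The v2 conjunct bites**: an empty `U`-block (`m = 0`) forces the output's `Π_U ↠ Π_V` to be
injective. [cite: MochizukiAbsTopII2013, Cor 3.7 (a) p.73] -/
theorem RealizesChain'.projU_injective_of_m_eq_zero (h : B.RealizesChain' C hP hΔ hne)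
    (h0 : B.chainParams.2.2 = 0) : Function.Injective B.projU.arith := by
  obtain ⟨c, -, -, w, s, t, -, hst, -, eU, eV, -, -, ψ, -, -, hψs, -, hψt⟩ := h
  have hst' : s = t := Fin.ext (by omega)
  subst hst'
  intro x y hxy
  have hx := hψt x
  have hy := hψt y
  rw [hψs] at hx hy
  have : eV.symm (eU x) = eV.symm (eU y) := Subtype.ext (by rw [hx, hy, hxy])
  exact eU.injective (eV.symm.injective this)

/-- When `n = 0` (`W = U`, the Belyi map étale on all of `U`) the v2 predicate implies the v1 predicate
(same slots). [cite: MochizukiAbsTopII2013, Ex 3.6 (i) p.71] -/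
theorem RealizesChain'.realizesChain_of_n_eq_zero (h : B.RealizesChain' C hP hΔ hne)
    (h0 : B.chainParams.2.1 = 0) : B.RealizesChain C hP hΔ hne := by
  obtain ⟨c, htype, hiso, w, s, t, hws, hst, ht, eU, eV, gU, gV, ψ, hU, hV, hψs, hsteps, hψt⟩ := h
  exact ⟨c, htype, hiso, s, t, by omega, ht, eU, eV, gU, gV, ψ, hU, hV, hψs, hsteps, hψt⟩

/-- Conversely, when `n = 0` the v1 predicate implies the v2 predicate (with `w = s`).
[cite: MochizukiAbsTopII2013, Ex 3.6 (i) p.71] -/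
theorem RealizesChain.realizesChain'_of_n_eq_zero (h : B.RealizesChain C hP hΔ hne)
    (h0 : B.chainParams.2.1 = 0) : B.RealizesChain' C hP hΔ hne := by
  obtain ⟨c, htype, hiso, s, t, hst, ht, eU, eV, gU, gV, ψ, hU, hV, hψs, hsteps, hψt⟩ := h
  exact ⟨c, htype, hiso, s, s, t, by omega, by omega, ht, eU, eV, gU, gV, ψ, hU, hV, hψs, hsteps, hψt⟩

end BelyiCuspidalization

namespace BelyiModel

variable {𝒟 : ConstructionDataClass.{u}} {M : BelyiModel 𝒟}

/-- **Cor 3.7″ ⟹ Cor 3.7** (the recorded predicate, p407799): same output, same chain.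
[cite: MochizukiAbsTopII2013, Cor 3.7 pp.72-73] -/
theorem cor_3_7_of_cor_3_7'' (h : M.Cor_3_7'') : M.Cor_3_7 := by
  intro hfull hGC b X hX U
  obtain ⟨B, hiso, hdec, hchain⟩ := h hfull hGC b X hX U
  exact ⟨B, hiso, hdec, hchain.hasTerminalChainOfType⟩

end BelyiModel

end Literature.AnabelianGeometry.AbsoluteAnabelian.AbsTopII
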